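import Summits.Ventures.PercRepro.RankLevelSetRuleQCell

/-!
# PercRepro — RULE Q AT THE TIGHT LAYER: THE CELL INEQUALITIES `RhatCell q k` BY KERNEL EVALUATION (RankLevelSetRuleQCellEvalQ3B; night-1, gen 14)

Each theorem `rhatCell_q_k : RhatCell q k` (`∀ m ≤ q, Φ(q+k, q) ≤ R̂(q, k, m)`, RankLevelSetRuleQCell) is discharged by
`interval_cases m` and `norm_num` on the unfolded binomial sums (`Nat.choose` by its recursion; the
`Finset.Ioo`-sums as `Finset.range`-sums via `sum_Ioo_nat`). No `native_decide`, no `decide` on the rationals. With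
`hallUp_of_ncard_eq_of_rhatCell` each cell gives the UP form of C-044 at the tight layer `#E = (q+k) + q` of the cell
`(q+k, q)` for every finite matroid; the DOWN form is `hallDown_of_ncard_eq`. Cells: (3,14), (3,15), (3,16), (3,17), (3,18).
Axioms: standard.
-/

namespace PercRepro

open Finset

/-- `Φ(17, 3) ≤ R̂(3, 14, 0)` (the cell `(17, 3)` at `#P = 0`), by kernel evaluation. -/
theorem rhatCell_3_14_0 : phiK (3 + 14) 3 ≤ rhat 3 14 0 := by
  simp only [rhat, phiK, mhat, sum_Ioo_nat]
  norm_num [Finset.sum_range_succ, Nat.choose, Nat.min_def]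

/-- `Φ(17, 3) ≤ R̂(3, 14, 1)` (the cell `(17, 3)` at `#P = 1`), by kernel evaluation. -/
theorem rhatCell_3_14_1 : phiK (3 + 14) 3 ≤ rhat 3 14 1 := by
  simp only [rhat, phiK, mhat, sum_Ioo_nat]
  norm_num [Finset.sum_range_succ, Nat.choose, Nat.min_def]

/-- `Φ(17, 3) ≤ R̂(3, 14, 2)` (the cell `(17, 3)` at `#P = 2`), by kernel evaluation. -/
theorem rhatCell_3_14_2 : phiK (3 + 14) 3 ≤ rhat 3 14 2 := by
  simp only [rhat, phiK, mhat, sum_Ioo_nat]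
  norm_num [Finset.sum_range_succ, Nat.choose, Nat.min_def]

/-- `Φ(17, 3) ≤ R̂(3, 14, 3)` (the cell `(17, 3)` at `#P = 3`), by kernel evaluation. -/
theorem rhatCell_3_14_3 : phiK (3 + 14) 3 ≤ rhat 3 14 3 := by
  simp only [rhat, phiK, mhat, sum_Ioo_nat]
  norm_num [Finset.sum_range_succ, Nat.choose, Nat.min_def]

/-- The cell `(17, 3)` (`q = 3`, `k = 14`): `Φ(17, 3) ≤ R̂(3, 14, m)` for every `m ≤ 3`. -/
theorem rhatCell_3_14 : RhatCell 3 14 := by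
  intro m hm
  interval_cases m
  · exact rhatCell_3_14_0
  · exact rhatCell_3_14_1
  · exact rhatCell_3_14_2
  · exact rhatCell_3_14_3

/-- `Φ(18, 3) ≤ R̂(3, 15, 0)` (the cell `(18, 3)` at `#P = 0`), by kernel evaluation. -/
theorem rhatCell_3_15_0 : phiK (3 + 15) 3 ≤ rhat 3 15 0 := by
  simp only [rhat, phiK, mhat, sum_Ioo_nat]
  norm_num [Finset.sum_range_succ, Nat.choose, Nat.min_def]

/-- `Φ(18, 3) ≤ R̂(3, 15, 1)` (the cell `(18, 3)` at `#P = 1`), by kernel evaluation. -/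
theorem rhatCell_3_15_1 : phiK (3 + 15) 3 ≤ rhat 3 15 1 := by
  simp only [rhat, phiK, mhat, sum_Ioo_nat]
  norm_num [Finset.sum_range_succ, Nat.choose, Nat.min_def]

/-- `Φ(18, 3) ≤ R̂(3, 15, 2)` (the cell `(18, 3)` at `#P = 2`), by kernel evaluation. -/
theorem rhatCell_3_15_2 : phiK (3 + 15) 3 ≤ rhat 3 15 2 := by
  simp only [rhat, phiK, mhat, sum_Ioo_nat]
  norm_num [Finset.sum_range_succ, Nat.choose, Nat.min_def]

/-- `Φ(18, 3) ≤ R̂(3, 15, 3)` (the cell `(18, 3)` at `#P = 3`), by kernel evaluation. -/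
theorem rhatCell_3_15_3 : phiK (3 + 15) 3 ≤ rhat 3 15 3 := by
  simp only [rhat, phiK, mhat, sum_Ioo_nat]
  norm_num [Finset.sum_range_succ, Nat.choose, Nat.min_def]

/-- The cell `(18, 3)` (`q = 3`, `k = 15`): `Φ(18, 3) ≤ R̂(3, 15, m)` for every `m ≤ 3`. -/
theorem rhatCell_3_15 : RhatCell 3 15 := by
  intro m hm
  interval_cases m
  · exact rhatCell_3_15_0
  · exact rhatCell_3_15_1
  · exact rhatCell_3_15_2
  · exact rhatCell_3_15_3

/-- `Φ(19, 3) ≤ R̂(3, 16, 0)` (the cell `(19, 3)` at `#P = 0`), by kernel evaluation. -/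
theorem rhatCell_3_16_0 : phiK (3 + 16) 3 ≤ rhat 3 16 0 := by
  simp only [rhat, phiK, mhat, sum_Ioo_nat]
  norm_num [Finset.sum_range_succ, Nat.choose, Nat.min_def]

/-- `Φ(19, 3) ≤ R̂(3, 16, 1)` (the cell `(19, 3)` at `#P = 1`), by kernel evaluation. -/
theorem rhatCell_3_16_1 : phiK (3 + 16) 3 ≤ rhat 3 16 1 := by
  simp only [rhat, phiK, mhat, sum_Ioo_nat]
  norm_num [Finset.sum_range_succ, Nat.choose, Nat.min_def]

/-- `Φ(19, 3) ≤ R̂(3, 16, 2)` (the cell `(19, 3)` at `#P = 2`), by kernel evaluation. -/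
theorem rhatCell_3_16_2 : phiK (3 + 16) 3 ≤ rhat 3 16 2 := by
  simp only [rhat, phiK, mhat, sum_Ioo_nat]
  norm_num [Finset.sum_range_succ, Nat.choose, Nat.min_def]

/-- `Φ(19, 3) ≤ R̂(3, 16, 3)` (the cell `(19, 3)` at `#P = 3`), by kernel evaluation. -/
theorem rhatCell_3_16_3 : phiK (3 + 16) 3 ≤ rhat 3 16 3 := by
  simp only [rhat, phiK, mhat, sum_Ioo_nat]
  norm_num [Finset.sum_range_succ, Nat.choose, Nat.min_def]

/-- The cell `(19, 3)` (`q = 3`, `k = 16`): `Φ(19, 3) ≤ R̂(3, 16, m)` for every `m ≤ 3`. -/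
theorem rhatCell_3_16 : RhatCell 3 16 := by
  intro m hm
  interval_cases m
  · exact rhatCell_3_16_0
  · exact rhatCell_3_16_1
  · exact rhatCell_3_16_2
  · exact rhatCell_3_16_3

/-- `Φ(20, 3) ≤ R̂(3, 17, 0)` (the cell `(20, 3)` at `#P = 0`), by kernel evaluation. -/
theorem rhatCell_3_17_0 : phiK (3 + 17) 3 ≤ rhat 3 17 0 := by
  simp only [rhat, phiK, mhat, sum_Ioo_nat]
  norm_num [Finset.sum_range_succ, Nat.choose, Nat.min_def]

/-- `Φ(20, 3) ≤ R̂(3, 17, 1)` (the cell `(20, 3)` at `#P = 1`), by kernel evaluation. -/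
theorem rhatCell_3_17_1 : phiK (3 + 17) 3 ≤ rhat 3 17 1 := by
  simp only [rhat, phiK, mhat, sum_Ioo_nat]
  norm_num [Finset.sum_range_succ, Nat.choose, Nat.min_def]

/-- `Φ(20, 3) ≤ R̂(3, 17, 2)` (the cell `(20, 3)` at `#P = 2`), by kernel evaluation. -/
theorem rhatCell_3_17_2 : phiK (3 + 17) 3 ≤ rhat 3 17 2 := by
  simp only [rhat, phiK, mhat, sum_Ioo_nat]
  norm_num [Finset.sum_range_succ, Nat.choose, Nat.min_def]

/-- `Φ(20, 3) ≤ R̂(3, 17, 3)` (the cell `(20, 3)` at `#P = 3`), by kernel evaluation. -/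
theorem rhatCell_3_17_3 : phiK (3 + 17) 3 ≤ rhat 3 17 3 := by
  simp only [rhat, phiK, mhat, sum_Ioo_nat]
  norm_num [Finset.sum_range_succ, Nat.choose, Nat.min_def]

/-- The cell `(20, 3)` (`q = 3`, `k = 17`): `Φ(20, 3) ≤ R̂(3, 17, m)` for every `m ≤ 3`. -/
theorem rhatCell_3_17 : RhatCell 3 17 := by
  intro m hm
  interval_cases m
  · exact rhatCell_3_17_0
  · exact rhatCell_3_17_1
  · exact rhatCell_3_17_2
  · exact rhatCell_3_17_3

/-- `Φ(21, 3) ≤ R̂(3, 18, 0)` (the cell `(21, 3)` at `#P = 0`), by kernel evaluation. -/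
theorem rhatCell_3_18_0 : phiK (3 + 18) 3 ≤ rhat 3 18 0 := by
  simp only [rhat, phiK, mhat, sum_Ioo_nat]
  norm_num [Finset.sum_range_succ, Nat.choose, Nat.min_def]

/-- `Φ(21, 3) ≤ R̂(3, 18, 1)` (the cell `(21, 3)` at `#P = 1`), by kernel evaluation. -/
theorem rhatCell_3_18_1 : phiK (3 + 18) 3 ≤ rhat 3 18 1 := by
  simp only [rhat, phiK, mhat, sum_Ioo_nat]
  norm_num [Finset.sum_range_succ, Nat.choose, Nat.min_def]

/-- `Φ(21, 3) ≤ R̂(3, 18, 2)` (the cell `(21, 3)` at `#P = 2`), by kernel evaluation. -/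
theorem rhatCell_3_18_2 : phiK (3 + 18) 3 ≤ rhat 3 18 2 := by
  simp only [rhat, phiK, mhat, sum_Ioo_nat]
  norm_num [Finset.sum_range_succ, Nat.choose, Nat.min_def]

/-- `Φ(21, 3) ≤ R̂(3, 18, 3)` (the cell `(21, 3)` at `#P = 3`), by kernel evaluation. -/
theorem rhatCell_3_18_3 : phiK (3 + 18) 3 ≤ rhat 3 18 3 := by
  simp only [rhat, phiK, mhat, sum_Ioo_nat]
  norm_num [Finset.sum_range_succ, Nat.choose, Nat.min_def]

/-- The cell `(21, 3)` (`q = 3`, `k = 18`): `Φ(21, 3) ≤ R̂(3, 18, m)` for every `m ≤ 3`. -/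
theorem rhatCell_3_18 : RhatCell 3 18 := by
  intro m hm
  interval_cases m
  · exact rhatCell_3_18_0
  · exact rhatCell_3_18_1
  · exact rhatCell_3_18_2
  · exact rhatCell_3_18_3

end PercRepro
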